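import Literature.NumberTheory.GaloisCohomology.Howard2004.TowerSelmerLiftGlobalDualityProofs
import HarnessLib

/-!
# Howard 2004, Prop. 1.4.1 — the Poitou–Tate VALUE `∑_v inv_v(m_v ∪ y_v)` on liftable classes is independent
# of the global lift and of the local defects (pairing-free well-definedness) — proofs file

Topic `NumberTheory/GaloisCohomology/Howard2004`. THEOREMS ONLY: no definition, no named fact, no instance, no notation,
no `sorry`.  Cell `pub/bsd-print-x9` (seat x10b-p1-w8 g12, brick «C451-LIFT-WD», `--supports stmt-BirchSwinnertonDyer-22642`;
print leaf G87 ↦ the «Flach leaf» C45.1′ / C45.1″).  Sequel of `TowerSelmerLiftGlobalDualityProofs` (LIFT-PT): there, for a class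
`a` reducing from a GLOBAL lift `ã ∈ H¹(K, N_{t+1})` with local defects `m_v ∈ H¹(K_v, N_0)` (`loc_v ã - ℓ_v = ι_v m_v`,
`ℓ_v ∈ 𝓕(n)_{t+1,v}`), the Selmer lift criterion reads on the functional `y ↦ ∑_{v ∈ Σ} inv_v(m_v ∪ loc_v y)` on
`H¹_{𝓕(n)_0^*}(K, N_0^*)`.  HERE: that functional depends on `a` alone — not on the lift `ã`, the defects `m` or the
finite set `Σ` — which is what makes it the VALUE of a pairing on the liftable classes (the classes with vanishing
`Ш²(K, N_0)`-obstruction; under H.0–H.5 these will be all of `H¹_{𝓕(n)}(K, N_t)`).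

SOURCE. B. Howard, *The Heegner point Kolyvagin system*, Compositio Math. **140** (2004) = arXiv:1202.6340, §1.4 (p0008 L60–81:
the local lifts `β'_v` and «the value … does not depend on the choices made», proof «left to the reader» after Flach); M. Flach,
*A generalisation of the Cassels–Tate pairing*, J. reine angew. Math. **412** (1990) 113–127 (independence of choices);
A. Morgan, A. Smith, arXiv:2103.08530, Prop. 3.3 (well-definedness).

* §1 **`sum_localTatePairingZMod_defects_eq_of_redLEH1_eq`** — for ONE class `a` and TWO data `(ã, m)`, `(ã', m')` over a common
  finite set `Σ` (both defect families supported on `Σ`):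
  `∑_{v ∈ Σ} inv_v(m_v ∪ y_v) = ∑_{v ∈ Σ} inv_v(m'_v ∪ y_v)` for every `y ∈ H¹_{𝓕(n)_0^*}(K, N_0^*)` — `ã - ã' = H¹(ι) x`
  (middle exactness), `m_v - m'_v - loc_v x ∈ 𝓕(n)_{0,v}` (cartesian), local annihilation and `∑_v ⟨x_v, y_v⟩_v = 0`.
* §2 **`sum_localTatePairingZMod_defects_eq_of_subset`** — enlarging `Σ` does not change the sum (the defects vanish off `Σ`);
  **`sum_localTatePairingZMod_defects_eq`** — the general comparison (two data, two finite sets).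
* §3 **`localDefects_add`** — additivity in `a`: defects of a sum may be taken to be the sums of defects (so the value is additive in `a`; it is additive in `y` termwise).

HONEST FRAMING: no pairing is constructed as an object (THEOREMS ONLY); Prop. 1.4.1, Thm. 1.4.2, C45.1′/C45.1″ and
`thm161_dvrKolyvaginBound` are NOT proved; no summit statement is proved; the Birch–Swinnerton-Dyer conjecture is not proved
by any of this.
-/

set_option autoImplicit false

noncomputable section

namespace Literature.NumberTheory.GaloisCohomology.Howard2004

open Function NumberField IsDedekindDomain Field CategoryTheory
open scoped NumberField ContRepresentation
open Literature.NumberTheory.GaloisRepresentations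
open Literature.NumberTheory.GaloisRepresentations.DiscreteGaloisModule
open Literature.NumberTheory.GaloisCohomology (LocalInvariants)

namespace DVRSetting

variable {p : ℕ} [Fact p.Prime] {K : Type} [Field K] [NumberField K]
  {R : Type} [CommRing R] [IsDomain R] [IsDiscreteValuationRing R] [Algebra ℤ_[p] R]
  {N : ℕ → Type} [∀ k, AddCommGroup (N k)] [∀ k, TopologicalSpace (N k)]
  [∀ k, DiscreteTopology (N k)] [∀ k, Module R (N k)]
  {Rk : ℕ → Type} [∀ k, CommRing (Rk k)] [∀ k, IsLocalRing (Rk k)] [∀ k, TopologicalSpace (Rk k)]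
  [∀ k, DiscreteTopology (Rk k)] [∀ k, Algebra ℤ_[p] (Rk k)] [∀ k, Algebra R (Rk k)]
  [∀ k, Module (Rk k) (N k)] [∀ k, IsScalarTower R (Rk k) (N k)]
  {Nbar : Type} [AddCommGroup Nbar] [TopologicalSpace Nbar] [DiscreteTopology Nbar]
  [∀ k, Module (Rk k) Nbar]
  {Nq : ℕ → Finset (HeightOneSpectrum (𝓞 K)) → Type} [∀ k n, AddCommGroup (Nq k n)]
  [∀ k n, TopologicalSpace (Nq k n)] [∀ k n, DiscreteTopology (Nq k n)]
  [∀ k n, Module (Rk k) (Nq k n)] [∀ k n, Module R (Nq k n)]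
  [∀ k n, IsScalarTower R (Rk k) (Nq k n)]

/-! ## §1 Two lifts, two defect families, one finite set -/

/-- **The value is independent of the lift and of the defects.**  In the setting of `TowerSelmerLiftGlobalDualityProofs`
(`ι : N_0 → N_{t+1}` presenting `ker red_{t+1→i}`, cartesian for `𝓕(n)`; a family `inv` with the reciprocity law
`SumLocalTermEqZero` at a level `n₀` killing `N_0`): if `ã, ã' ∈ H¹(K, N_{t+1})` reduce to the SAME class and `m, m'` are
local defects of `ã, ã'` (`loc_v ã - ℓ_v = ι_v m_v`, `loc_v ã' - ℓ'_v = ι_v m'_v`, `ℓ_v, ℓ'_v ∈ 𝓕(n)_{t+1,v}`), both supported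
on a finite set of places `Σ`, then for every `y ∈ H¹_{𝓕(n)_0^*}(K, N_0^*)`:
`∑_{v ∈ Σ} inv_v(m_v ∪ loc_v y) = ∑_{v ∈ Σ} inv_v(m'_v ∪ loc_v y)`.
Proof: `ã - ã' = H¹(ι) x` for a global `x` (middle exactness); `ι_v(m_v - m'_v - loc_v x) = ℓ'_v - ℓ_v ∈ 𝓕(n)_{t+1,v}`, so
`m_v - m'_v - loc_v x ∈ 𝓕(n)_{0,v}` pairs to zero with `y_v ∈ 𝓕(n)_{0,v}^*`; and `∑_{v ∈ Σ} ⟨x_v, y_v⟩_v = 0` by reciprocity,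
the terms off `Σ` vanishing because there `-loc_v x ∈ 𝓕(n)_{0,v}`.
[cite: Howard2004HeegnerKolyvagin, §1.4 (arXiv:1202.6340 p0008 L60–81: the choices and their independence) and Thm. 1.1.11]
[cite: Flach1990, independence of the choices in the definition of the pairing] -/
theorem sum_localTatePairingZMod_defects_eq_of_redLEH1_eq (S : DVRSetting p K R N Rk Nbar Nq) [Finite (N 0)]
    {i t : ℕ} (hit : i ≤ t + 1) (n : Finset (HeightOneSpectrum (𝓞 K))) (ι : N 0 →ₗ[R] N (t + 1))
    (hιg : ∀ (g : absoluteGaloisGroup K) (x : N 0), ι (S.T.ρ 0 g x) = S.T.ρ (t + 1) g (ι x))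
    (hιinj : Function.Injective ι) (hιex : ∀ y : N (t + 1), S.T.redLE hit y = 0 ↔ ∃ x, ι x = y)
    (hιF : ∀ (v : Place K) (m : galoisCohomology ((S.T.ρ 0).toLocal v) 1),
      ContinuousRep.cohomologyMap ((S.T.ρ 0).toLocal v) ((S.T.ρ (t + 1)).toLocal v) ι.toAddMonoidHom
          continuous_of_discreteTopology (fun _ x => hιg _ x) 1 m ∈ ((S.t (t + 1)).atLevel S.jbar n).cond v ↔
        m ∈ ((S.t 0).atLevel S.jbar n).cond v)
    {n₀ : ℕ} [NeZero n₀] (hM : ∀ x : N 0, n₀ • x = 0) (inv : LocalInvariants K n₀) (hPT : inv.SumLocalTermEqZero)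
    (Sfin : Finset (Place K))
    (ã ã' : galoisCohomology (S.T.ρ (t + 1)) 1) (hãã' : S.redLEH1 hit ã = S.redLEH1 hit ã')
    (m m' : ∀ v : Place K, galoisCohomology ((S.T.ρ 0).toLocal v) 1)
    (hm : ∀ v, ∃ ℓ ∈ ((S.t (t + 1)).atLevel S.jbar n).cond v,
      galoisCohomology.localization (S.T.ρ (t + 1)) v 1 ã - ℓ =
        ContinuousRep.cohomologyMap ((S.T.ρ 0).toLocal v) ((S.T.ρ (t + 1)).toLocal v) ι.toAddMonoidHom
          continuous_of_discreteTopology (fun _ x => hιg _ x) 1 (m v))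
    (hm' : ∀ v, ∃ ℓ ∈ ((S.t (t + 1)).atLevel S.jbar n).cond v,
      galoisCohomology.localization (S.T.ρ (t + 1)) v 1 ã' - ℓ =
        ContinuousRep.cohomologyMap ((S.T.ρ 0).toLocal v) ((S.T.ρ (t + 1)).toLocal v) ι.toAddMonoidHom
          continuous_of_discreteTopology (fun _ x => hιg _ x) 1 (m' v))
    (hmS : ∀ v ∉ Sfin, m v = 0) (hm'S : ∀ v ∉ Sfin, m' v = 0)
    {y : galoisCohomology ((S.T.ρ 0).tateDual n₀) 1}
    (hy' : y ∈ (inv.dualSelmerStructure (S.T.ρ 0) ((S.t 0).atLevel S.jbar n).cond).selmerGroup) :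
    ∑ v ∈ Sfin, localTatePairingZMod (S.T.ρ 0) n₀ v (inv v) (m v)
        (galoisCohomology.localization ((S.T.ρ 0).tateDual n₀) v 1 y) =
      ∑ v ∈ Sfin, localTatePairingZMod (S.T.ρ 0) n₀ v (inv v) (m' v)
        (galoisCohomology.localization ((S.T.ρ 0).tateDual n₀) v 1 y) := by
  classical
  -- notation, as in `TowerSelmerLiftGlobalDualityProofs`
  let ιH : galoisCohomology (S.T.ρ 0) 1 →+ galoisCohomology (S.T.ρ (t + 1)) 1 :=
    ContinuousRep.cohomologyMap (S.T.ρ 0) (S.T.ρ (t + 1)) ι.toAddMonoidHom continuous_of_discreteTopology hιg 1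
  have hιH : ∀ b, ContinuousRep.cohomologyMap (S.T.ρ 0) (S.T.ρ (t + 1)) ι.toAddMonoidHom
      continuous_of_discreteTopology hιg 1 b = ιH b := fun _ => rfl
  let ιL : ∀ v : Place K,
      galoisCohomology ((S.T.ρ 0).toLocal v) 1 →+ galoisCohomology ((S.T.ρ (t + 1)).toLocal v) 1 := fun v =>
    ContinuousRep.cohomologyMap ((S.T.ρ 0).toLocal v) ((S.T.ρ (t + 1)).toLocal v) ι.toAddMonoidHom
      continuous_of_discreteTopology (fun _ x => hιg _ x) 1
  have hιF' : ∀ (v : Place K) (z : galoisCohomology ((S.T.ρ 0).toLocal v) 1),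
      ιL v z ∈ ((S.t (t + 1)).atLevel S.jbar n).cond v ↔ z ∈ ((S.t 0).atLevel S.jbar n).cond v := hιF
  have hm₁ : ∀ v, ∃ ℓ ∈ ((S.t (t + 1)).atLevel S.jbar n).cond v,
      galoisCohomology.localization (S.T.ρ (t + 1)) v 1 ã - ℓ = ιL v (m v) := hm
  have hm₂ : ∀ v, ∃ ℓ ∈ ((S.t (t + 1)).atLevel S.jbar n).cond v,
      galoisCohomology.localization (S.T.ρ (t + 1)) v 1 ã' - ℓ = ιL v (m' v) := hm'
  have hloc : ∀ (v : Place K) (x : galoisCohomology (S.T.ρ 0) 1),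
      galoisCohomology.localization (S.T.ρ (t + 1)) v 1 (ιH x) =
        ιL v (galoisCohomology.localization (S.T.ρ 0) v 1 x) :=
    fun v x => localization_cohomologyMap_one (S.T.ρ 0) (S.T.ρ (t + 1)) ι.toAddMonoidHom hιg v x
  set 𝓕₀ : SelmerStructure (S.T.ρ 0) := ((S.t 0).atLevel S.jbar n).cond with h𝓕₀
  -- `ã - ã' = H¹(ι) x`
  have h0 : S.redLEH1 hit (ã - ã') = 0 := by rw [map_sub, hãã', sub_self]
  obtain ⟨x, hx⟩ := S.exists_cohomologyMap_eq_of_redLEH1_eq_zero hit ι hιg hιinj hιex (ã - ã') h0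
  rw [hιH] at hx
  -- `m_v - m'_v - loc_v x ∈ 𝓕(n)_{0,v}` at every place
  have hdef : ∀ v, m v - m' v - galoisCohomology.localization (S.T.ρ 0) v 1 x ∈ 𝓕₀ v := by
    intro v
    obtain ⟨ℓ, hℓ, hℓeq⟩ := hm₁ v
    obtain ⟨ℓ', hℓ', hℓ'eq⟩ := hm₂ v
    rw [← hιF' v, map_sub, map_sub, ← hℓeq, ← hℓ'eq, ← hloc v x, hx, map_sub]
    have h2 := (((S.t (t + 1)).atLevel S.jbar n).cond v).sub_mem hℓ' hℓ
    convert h2 using 1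
    abel
  -- termwise: `⟨m_v, y_v⟩ - ⟨m'_v, y_v⟩ = ⟨x_v, y_v⟩`
  have hyv : ∀ v, galoisCohomology.localization ((S.T.ρ 0).tateDual n₀) v 1 y ∈
      inv.dualLocalCondition (S.T.ρ 0) v (𝓕₀ v) := fun v => (SelmerStructure.mem_selmerGroup_iff _ _).1 hy' v
  have hterm : ∀ v, localTatePairingZMod (S.T.ρ 0) n₀ v (inv v) (m v)
        (galoisCohomology.localization ((S.T.ρ 0).tateDual n₀) v 1 y) -
      localTatePairingZMod (S.T.ρ 0) n₀ v (inv v) (m' v)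
        (galoisCohomology.localization ((S.T.ρ 0).tateDual n₀) v 1 y) = inv.localTerm (S.T.ρ 0) v x y := by
    intro v
    have h1 := (LocalInvariants.mem_dualLocalCondition_iff _ _ _ _ _).1 (hyv v) _ (hdef v)
    rw [map_sub, map_sub, AddMonoidHom.sub_apply, AddMonoidHom.sub_apply, sub_eq_zero] at h1
    rw [h1, LocalInvariants.localTerm_apply, localTatePairingZMod_apply]
  -- sum and reciprocity
  rw [← sub_eq_zero, ← Finset.sum_sub_distrib]
  simp_rw [hterm]
  refine hPT (S.T.ρ 0) hM x y Sfin fun v hv => ?_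
  have hxv : galoisCohomology.localization (S.T.ρ 0) v 1 x ∈ 𝓕₀ v := by
    have h1 := hdef v
    rw [hmS v hv, hm'S v hv, sub_self, zero_sub] at h1
    exact neg_mem_iff.1 h1
  exact inv.localTerm_eq_zero_of_mem_of_mem_dual (S.T.ρ 0) v (𝓕₀ v) hxv (hyv v)

/-! ## §2 Enlarging the finite set; two data over two finite sets -/

/-- **Enlarging `Σ` does not change the value**: a defect family supported on `Σ ⊆ Σ'` has the same sum over `Σ'` (the new
terms are `inv_v(0 ∪ y_v) = 0`). [folklore]
[cite: Howard2004HeegnerKolyvagin, §1.4 (arXiv:1202.6340 p0008 L60–81)] -/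
theorem sum_localTatePairingZMod_defects_eq_of_subset (S : DVRSetting p K R N Rk Nbar Nq) [Finite (N 0)]
    {n₀ : ℕ} (inv : LocalInvariants K n₀) {Sfin Sfin' : Finset (Place K)} (hsub : Sfin ⊆ Sfin')
    (m : ∀ v : Place K, galoisCohomology ((S.T.ρ 0).toLocal v) 1) (hmS : ∀ v ∉ Sfin, m v = 0)
    (y : galoisCohomology ((S.T.ρ 0).tateDual n₀) 1) :
    ∑ v ∈ Sfin', localTatePairingZMod (S.T.ρ 0) n₀ v (inv v) (m v)
        (galoisCohomology.localization ((S.T.ρ 0).tateDual n₀) v 1 y) =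
      ∑ v ∈ Sfin, localTatePairingZMod (S.T.ρ 0) n₀ v (inv v) (m v)
        (galoisCohomology.localization ((S.T.ρ 0).tateDual n₀) v 1 y) := by
  classical
  refine (Finset.sum_subset hsub fun v _ hv => ?_).symm
  rw [hmS v hv, map_zero, AddMonoidHom.zero_apply]

/-- **Two data, two finite sets**: in the situation of `sum_localTatePairingZMod_defects_eq_of_redLEH1_eq`, with `(ã, m)`
supported on `Σ` and `(ã', m')` supported on `Σ'`, the two values agree (pass to `Σ ∪ Σ'`).
[cite: Howard2004HeegnerKolyvagin, §1.4 (arXiv:1202.6340 p0008 L60–81) and Thm. 1.1.11] [cite: Flach1990, independence of the choices] -/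
theorem sum_localTatePairingZMod_defects_eq (S : DVRSetting p K R N Rk Nbar Nq) [Finite (N 0)]
    {i t : ℕ} (hit : i ≤ t + 1) (n : Finset (HeightOneSpectrum (𝓞 K))) (ι : N 0 →ₗ[R] N (t + 1))
    (hιg : ∀ (g : absoluteGaloisGroup K) (x : N 0), ι (S.T.ρ 0 g x) = S.T.ρ (t + 1) g (ι x))
    (hιinj : Function.Injective ι) (hιex : ∀ y : N (t + 1), S.T.redLE hit y = 0 ↔ ∃ x, ι x = y)
    (hιF : ∀ (v : Place K) (m : galoisCohomology ((S.T.ρ 0).toLocal v) 1),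
      ContinuousRep.cohomologyMap ((S.T.ρ 0).toLocal v) ((S.T.ρ (t + 1)).toLocal v) ι.toAddMonoidHom
          continuous_of_discreteTopology (fun _ x => hιg _ x) 1 m ∈ ((S.t (t + 1)).atLevel S.jbar n).cond v ↔
        m ∈ ((S.t 0).atLevel S.jbar n).cond v)
    {n₀ : ℕ} [NeZero n₀] (hM : ∀ x : N 0, n₀ • x = 0) (inv : LocalInvariants K n₀) (hPT : inv.SumLocalTermEqZero)
    (Sfin Sfin' : Finset (Place K))
    (ã ã' : galoisCohomology (S.T.ρ (t + 1)) 1) (hãã' : S.redLEH1 hit ã = S.redLEH1 hit ã')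
    (m m' : ∀ v : Place K, galoisCohomology ((S.T.ρ 0).toLocal v) 1)
    (hm : ∀ v, ∃ ℓ ∈ ((S.t (t + 1)).atLevel S.jbar n).cond v,
      galoisCohomology.localization (S.T.ρ (t + 1)) v 1 ã - ℓ =
        ContinuousRep.cohomologyMap ((S.T.ρ 0).toLocal v) ((S.T.ρ (t + 1)).toLocal v) ι.toAddMonoidHom
          continuous_of_discreteTopology (fun _ x => hιg _ x) 1 (m v))
    (hm' : ∀ v, ∃ ℓ ∈ ((S.t (t + 1)).atLevel S.jbar n).cond v,
      galoisCohomology.localization (S.T.ρ (t + 1)) v 1 ã' - ℓ =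
        ContinuousRep.cohomologyMap ((S.T.ρ 0).toLocal v) ((S.T.ρ (t + 1)).toLocal v) ι.toAddMonoidHom
          continuous_of_discreteTopology (fun _ x => hιg _ x) 1 (m' v))
    (hmS : ∀ v ∉ Sfin, m v = 0) (hm'S : ∀ v ∉ Sfin', m' v = 0)
    {y : galoisCohomology ((S.T.ρ 0).tateDual n₀) 1}
    (hy' : y ∈ (inv.dualSelmerStructure (S.T.ρ 0) ((S.t 0).atLevel S.jbar n).cond).selmerGroup) :
    ∑ v ∈ Sfin, localTatePairingZMod (S.T.ρ 0) n₀ v (inv v) (m v)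
        (galoisCohomology.localization ((S.T.ρ 0).tateDual n₀) v 1 y) =
      ∑ v ∈ Sfin', localTatePairingZMod (S.T.ρ 0) n₀ v (inv v) (m' v)
        (galoisCohomology.localization ((S.T.ρ 0).tateDual n₀) v 1 y) := by
  classical
  rw [← S.sum_localTatePairingZMod_defects_eq_of_subset inv (Finset.subset_union_left (s₂ := Sfin')) m hmS y,
    ← S.sum_localTatePairingZMod_defects_eq_of_subset inv (Finset.subset_union_right (s₁ := Sfin)) m' hm'S y]
  exact S.sum_localTatePairingZMod_defects_eq_of_redLEH1_eq hit n ι hιg hιinj hιex hιF hM inv hPT (Sfin ∪ Sfin') ã ã' hãã'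
    m m' hm hm' (fun v hv => hmS v fun h => hv (Finset.mem_union_left _ h))
    (fun v hv => hm'S v fun h => hv (Finset.mem_union_right _ h)) hy'

/-! ## §3 Additivity of the defects -/

/-- **Defects add**: if `m`, `m'` are local defects of `ã`, `ã'`, then `m + m'` is a family of local defects of `ã + ã'`
(the local conditions are subgroups). [folklore] [cite: Howard2004HeegnerKolyvagin, §1.4 (arXiv:1202.6340 p0008 L60–81)] -/
theorem localDefects_add (S : DVRSetting p K R N Rk Nbar Nq) {t : ℕ} (n : Finset (HeightOneSpectrum (𝓞 K)))
    (ι : N 0 →ₗ[R] N (t + 1))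
    (hιg : ∀ (g : absoluteGaloisGroup K) (x : N 0), ι (S.T.ρ 0 g x) = S.T.ρ (t + 1) g (ι x))
    (ã ã' : galoisCohomology (S.T.ρ (t + 1)) 1)
    (m m' : ∀ v : Place K, galoisCohomology ((S.T.ρ 0).toLocal v) 1)
    (hm : ∀ v, ∃ ℓ ∈ ((S.t (t + 1)).atLevel S.jbar n).cond v,
      galoisCohomology.localization (S.T.ρ (t + 1)) v 1 ã - ℓ =
        ContinuousRep.cohomologyMap ((S.T.ρ 0).toLocal v) ((S.T.ρ (t + 1)).toLocal v) ι.toAddMonoidHom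
          continuous_of_discreteTopology (fun _ x => hιg _ x) 1 (m v))
    (hm' : ∀ v, ∃ ℓ ∈ ((S.t (t + 1)).atLevel S.jbar n).cond v,
      galoisCohomology.localization (S.T.ρ (t + 1)) v 1 ã' - ℓ =
        ContinuousRep.cohomologyMap ((S.T.ρ 0).toLocal v) ((S.T.ρ (t + 1)).toLocal v) ι.toAddMonoidHom
          continuous_of_discreteTopology (fun _ x => hιg _ x) 1 (m' v)) :
    ∀ v, ∃ ℓ ∈ ((S.t (t + 1)).atLevel S.jbar n).cond v,
      galoisCohomology.localization (S.T.ρ (t + 1)) v 1 (ã + ã') - ℓ =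
        ContinuousRep.cohomologyMap ((S.T.ρ 0).toLocal v) ((S.T.ρ (t + 1)).toLocal v) ι.toAddMonoidHom
          continuous_of_discreteTopology (fun _ x => hιg _ x) 1 (m v + m' v) := by
  intro v
  let ιL : galoisCohomology ((S.T.ρ 0).toLocal v) 1 →+ galoisCohomology ((S.T.ρ (t + 1)).toLocal v) 1 :=
    ContinuousRep.cohomologyMap ((S.T.ρ 0).toLocal v) ((S.T.ρ (t + 1)).toLocal v) ι.toAddMonoidHom
      continuous_of_discreteTopology (fun _ x => hιg _ x) 1
  have hm₁ : ∃ ℓ ∈ ((S.t (t + 1)).atLevel S.jbar n).cond v,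
      galoisCohomology.localization (S.T.ρ (t + 1)) v 1 ã - ℓ = ιL (m v) := hm v
  have hm₂ : ∃ ℓ ∈ ((S.t (t + 1)).atLevel S.jbar n).cond v,
      galoisCohomology.localization (S.T.ρ (t + 1)) v 1 ã' - ℓ = ιL (m' v) := hm' v
  obtain ⟨ℓ, hℓ, hℓeq⟩ := hm₁
  obtain ⟨ℓ', hℓ', hℓ'eq⟩ := hm₂
  refine ⟨ℓ + ℓ', (((S.t (t + 1)).atLevel S.jbar n).cond v).add_mem hℓ hℓ', ?_⟩
  show galoisCohomology.localization (S.T.ρ (t + 1)) v 1 (ã + ã') - (ℓ + ℓ') = ιL (m v + m' v)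
  rw [map_add, map_add, ← hℓeq, ← hℓ'eq]
  abel

end DVRSetting

end Literature.NumberTheory.GaloisCohomology.Howard2004

end
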